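import Literature.IUT.HodgeArakelov.EtaleThetaDataOfSettingKummerCocycleOfTate
import Literature.NumberTheory.GaloisRepresentations.PadicAlgClKummerValuationRigidity
import Literature.AnabelianGeometry.EtaleTheta.CyclotomeTowerAllLevels

/-!
# [IUTchII] Prop 3.4 (i) / Cor 1.11 (b), binder `hgal`: **(HCYC) ⟸ (HGAL)** — the cyclotomic half of `hgal` DERIVED from the
# Galois half modulo the class-R [EtTh] §1 origin clauses («HCYC-FROM-HGAL», file 4: assembly)

S. Mochizuki, *Inter-universal Teichmüller theory II*, kurims manuscript (Dec. 2020): Prop 3.4 (i) pp. 91–92 («functorial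
algorithm … in the topological group `Π`»), Cor 1.11 (b) p. 49, Prop 1.4 p. 27 [cite: Mochizuki2012, Prop 3.4 (i) p.92] — claim
key DISPUTED (D-0012).  Refereed inputs BY NAME ([EtTh] = S. Mochizuki, Publ. RIMS **45** (2009)): Cor 2.18 (i) p. 60 (= FACT
F-0620, through `rangeAutOfCor218i` / `mem_PiYdd_iff_of_cor218_i`), §1 pp. 12–13 (the class-R origin clauses `IsEtThOrigin`,
`hYcl` = GAP G-w4d021-2, `IsTateOrigin` of abc-iut-L2; never asserted); [AbsTopIII] Cor 1.10 pp. 41–44 ((HGAL) itself, the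
remaining FACT-class input); classical: Serre, *Local Fields*, Ch. II §2 / Ch. X §3 (Kummer–valuation rigidity,
`Literature.NumberTheory.GaloisRepresentations.PadicAlgCl.kummer_valuation_rigidity`).  abc-iut cell, layer L6, WAVE-5 seat
abc-iut-w5-d169 (gen 5; holder lineage of node IUTchII:Prop3.4(i)); GAP-LEDGER G-w5d169-3 (binder `hgal` = (HGAL) ∧ (HCYC) of
`EtaleLevels.prop34i_multiradiallyDefined_saturated_of{Galois,Core,Cor28i}`) and G-w5d145-2 (abc-iut-w5-d145's
`compatible_of_galois`, node IUTchII:Cor1.11): D-row D-G-w5d169-3 of 2026-08-26T11:4xZ — census correction «the cyclotomic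
half is not an independent missing functoriality» — HERE PROVED IN THE KERNEL.

PROOF-ONLY (no definition, no `Prop`-valued fact, nothing restated).
* `galMuN_conj_apply` — the Galois action on `μ_M` is abelian.
* **`hcyc_of_hgal`** — for the genuine data at an [EtTh] origin (`IsEtThOrigin`, `hYcl`, `IsTateOrigin`), under F-0620 at
  `C.rigidData` and `hq`, for ANY all-level cyclotome tower `τw`: a topological automorphism `α` of `Π^tp_{X̲̲}` with (HGAL)
  `aug(α x) = τ aug(x) τ⁻¹` satisfies (HCYC) in the EXACT form of the `hgal` binder:
  `∀ M z w, ᾱ z = w → red_M w = galMuN τ (red_M z)`.  Proof: file 2 (`exists_cyclotomeExponent_kummer_relation`: the exponent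
  `u_M(α)` with `u_M·[κ] = [κ ∘ α]`), file 3 (`kummer_cocycle_of_isTateOrigin`: `κ` is the Kummer cocycle of `q_X`), the
  classical `kummer_valuation_rigidity` (`u_M ≡ χ_cyc(τ) mod M`; its hypotheses: `‖q_X‖ < 1` from the setting, `τ⁻¹ q_X ∈ K` because
  `τ` normalises `G_K = aug(Π^tp_{X̲̲})` by (HGAL), compatibility of `u_M` from `red_modAll`), and `x^{u_M} = x^{χ(τ)} = τ·x` on `μ_M`.
* `hgal_of_hgalois` — hence the full binder `hgal` from its Galois half «∀ α ∃ τ, (HGAL)».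
NET: the FACT-class residual of nodes IUTchII:Prop3.4(i) (P3) and IUTchII:Cor1.11 is (HGAL) = [AbsTopIII] Cor 1.10 alone,
modulo the class-R §1 clauses.  Nothing here asserts anything of [IUTchII] or [EtTh]; no side taken on [IUTchIII] Cor 3.12;
typed ≠ proved for the binders.
-/

noncomputable section

open Topology

namespace Literature.IUT.HodgeArakelov

namespace EtaleThetaDataOfSetting

open Literature.AnabelianGeometry.EtaleTheta Literature.AnabelianGeometry.SemiGraphs
open Literature.NumberTheory.GaloisRepresentations

variable {p : ℕ} [Fact p.Prime] {D : Literature.AnabelianGeometry.EtaleTheta.ThetaSetting p}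
  {E : D.EtaleThetaData} {l : ℕ} (C : E.DoubleUnderline l)

/-! ### Small helpers: exponents modulo `M`, the abelian Galois action on `μ_M` -/

/-- In a group, `x^m = x^{(m mod M).toNat}` when `x^M = 1`. [folklore] -/
private theorem zpow_eq_pow_toNat {G : Type*} [Group G] {x : G} {M : ℕ+} (hx : x ^ (M : ℕ) = 1) (m : ℤ) :
    x ^ m = x ^ ((m % (M : ℤ)).toNat) := by
  have h0 : 0 ≤ m % (M : ℤ) := Int.emod_nonneg _ (by exact_mod_cast M.ne_zero)
  rw [zpow_eq_zpow_emod' m hx, ← zpow_natCast, Int.toNat_of_nonneg h0]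

/-- In `ℚ̄_p`, `ζ^m = ζ^{(m mod M).toNat}` when `ζ^M = 1`. [folklore] -/
private theorem zpow_eq_pow_toNat_field {ζ : PadicAlgCl p} {M : ℕ+} (hζ : ζ ^ (M : ℕ) = 1) (m : ℤ) :
    ζ ^ m = ζ ^ ((m % (M : ℤ)).toNat) := by
  have hζ0 : ζ ≠ 0 := by
    rintro rfl; rw [zero_pow M.ne_zero] at hζ; exact zero_ne_one hζ
  lift ζ to (PadicAlgCl p)ˣ using hζ0.isUnit
  have hu : ζ ^ (M : ℕ) = 1 := by
    apply Units.ext; push_cast; exact hζ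
  have := zpow_eq_pow_toNat hu m
  have := congrArg (fun u : (PadicAlgCl p)ˣ => (u : PadicAlgCl p)) this
  push_cast at this
  exact this

/-- The Galois action on `μ_M` is ABELIAN: `(τ σ τ⁻¹)·x = σ·x` (every automorphism of the cyclic group `μ_M` is a power
map). [cite: MochizukiEtTh2009, Def 2.10 p.44] -/
theorem galMuN_conj_apply {M : ℕ+} (σ τ : GQp p) (x : MuN p M) :
    galMuN p M (τ * σ * τ⁻¹) x = galMuN p M σ x := by
  obtain ⟨s, hs⟩ := MonoidHom.map_cyclic (galMuN p M σ).toMonoidHom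
  have hs' : ∀ y : MuN p M, galMuN p M σ y = y ^ s := hs
  rw [map_mul, map_mul, MulAut.mul_apply, MulAut.mul_apply, hs', map_zpow, ← MulAut.mul_apply, ← map_mul,
    mul_inv_cancel, map_one, MulAut.one_apply, hs']

/-! ### (HCYC) from (HGAL) -/

/-- **(HCYC) ⟸ (HGAL).**  For the genuine data of a `ThetaSetting` at an [EtTh] origin (`IsEtThOrigin`; closedness binder
`hYcl`, GAP G-w4d021-2; Tate clause `IsTateOrigin`, p. 13 — all class R, never asserted), under F-0620 ([EtTh] Cor 2.18 (i))
at `C.rigidData` and `hq`: EVERY topological automorphism `α` of `Π^tp_{X̲̲}` lying over `Inn(τ)|_{G_K}` ((HGAL):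
`aug(α x) = τ aug(x) τ⁻¹`) satisfies (HCYC) — its induced automorphism of `l·Δ_Θ ⊆ φ(Π^tp_{X̲̲})` acts on every
`μ_M ≅ (l·Δ_Θ) ⊗ ℤ/M` (through the tower's identifications `red_M`) as the Galois element `τ`.  This is the second conjunct of
the binder `hgal` of `EtaleLevels.prop34i_multiradiallyDefined_saturated_of{Galois,Core,Cor28i}` in its exact form.
Proof = files 1–3 + the classical Kummer–valuation rigidity: `u_M(α)·[κ_q] = [κ_q ∘ Inn τ]` at every level forces
`u_M ≡ χ_cyc(τ) (mod M)`. [cite: Mochizuki2012, Prop 3.4 (i) p.92] -/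
theorem hcyc_of_hgal (hO : D.IsEtThOrigin)
    (hYcl : (D.DtpY.map D.toHat.toMonoidHom).topologicalClosure ≤
      D.DtpY.map D.toHat.toMonoidHom ⊔ (⁅⁅D.DeltaHat, D.DeltaHat⁆, D.DeltaHat⁆).topologicalClosure)
    (hT : D.IsTateOrigin) (hS : D.Sec2Hyps) (hq : IsQuotientMap D.toTheta) {N : ℕ+} (μ : D.CyclotomeMod l N)
    (hC : D.Compat) (h15 : D.Prop15iii E hC) (L : C.CuspLabels) (R : RigidData.{0} N l)
    (hR : R = C.rigidData μ hC hS h15 L) (h218i : R.Cor218_i) {Es : Set ℕ+} (τw : D.CyclotomeTower l Es)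
    (α : (Pi C) ≃ₜ* (Pi C)) (τ : GQp p) (hgal : ∀ x : Pi C, aug C (α x) = τ * aug C x * τ⁻¹) :
    ∀ (M : ℕ+) (z w : D.lDeltaTheta l),
      ((rangeAutOfCor218i C μ hq hC hS h15 L R hR h218i α ⟨(z : D.GtpTheta), lDeltaTheta_le_phiRange C z.2⟩ :
          phiRange C) : D.GtpTheta) = (w : D.GtpTheta) →
        (τw.modAll M).red w = galMuN p M τ ((τw.modAll M).red z) := by
  classical
  haveI : FiniteDimensional ℚ_[p] D.K := D.finiteDimensional_K
  -- a geometric `Z`-generator `B`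
  obtain ⟨B, hB, hBY⟩ := exists_generator_delta C hS
  -- file 2 at every level: the exponent `u_M` and the `q`-Kummer relation
  have H2 := fun M : ℕ+ => exists_cyclotomeExponent_kummer_relation C hS hO hq μ hC h15 L R hR h218i α τ hgal
    (τw.modAll M) hB hBY
  choose u d y hy hd1 hyY hαB hu hrel using H2
  -- file 3 at every level: `κ` is the Kummer cocycle of `q_X`
  have H3 := fun M : ℕ+ => kummer_cocycle_of_isTateOrigin C hO hYcl hT M (τw.modAll M) hB hBY
  choose ζ r ξ w hζ hr hξ hκ using H3
  -- the exponent `c_M` of `τ` on `μ_M`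
  have Hc := fun M : ℕ+ => MonoidHom.map_cyclic (galMuN p M τ).toMonoidHom
  choose c hc using Hc
  have hc' : ∀ (M : ℕ+) (x : MuN p M), galMuN p M τ x = x ^ c M := fun M x => hc M x
  -- orders
  have hMpow : ∀ (M : ℕ+) (x : MuN p M), x ^ ((M : ℕ+) : ℕ) = 1 := fun M x => by
    have h := pow_card_eq_one (G := MuN p M) (x := x); rwa [card_MuN] at h
  have hordξ : ∀ M : ℕ+, orderOf (ξ M) = M := fun M => ((hξ M).eq_orderOf).symm
  -- the induced map on `l·Δ_Θ` as a function
  have hmemA : ∀ zz : D.lDeltaTheta l,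
      ((rangeAutOfCor218i C μ hq hC hS h15 L R hR h218i α ⟨(zz : D.GtpTheta), lDeltaTheta_le_phiRange C zz.2⟩ :
        phiRange C) : D.GtpTheta) ∈ D.lDeltaTheta l := fun zz =>
    (Subgroup.mem_subgroupOf).1 ((mem_lDeltaTheta_iff_rangeAutOfCor218i C μ hq hC hS h15 L R hR h218i α _).1
      ((Subgroup.mem_subgroupOf).2 zz.2))
  -- compatibility of `u` across levels
  have hucomp : ∀ M M' : ℕ+, (M : ℕ) ∣ M' → u M' ≡ u M [ZMOD M] := by
    intro M M' hMM'
    -- `x^{u M'} = x^{u M}` for all `x ∈ μ_M`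
    have key : ∀ zz : D.lDeltaTheta l, (τw.modAll M).red zz ^ u M' = (τw.modAll M).red zz ^ u M := by
      intro zz
      have h1 := hu M zz ⟨_, hmemA zz⟩ rfl
      have h2 := hu M' zz ⟨_, hmemA zz⟩ rfl
      rw [← h1, ← τw.red_modAll M M' hMM' zz, ← map_zpow, ← h2, τw.red_modAll M M' hMM']
    obtain ⟨zz, hzz⟩ := (τw.modAll M).red_surjective (ξ M)
    have h := key zz
    rw [hzz] at h
    rw [← hordξ M]
    exact zpow_eq_zpow_iff_modEq.1 h
  -- compatibility of `c` across levels
  have hccomp : ∀ M M' : ℕ+, (M : ℕ) ∣ M' → c M' ≡ c M [ZMOD M] := by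
    intro M M' hMM'
    obtain ⟨x', hx'⟩ := MuN.red_surjective p M M' hMM' (ξ M)
    have h : ξ M ^ c M' = ξ M ^ c M := by
      rw [← hc' M, ← hx', ← MuN.red_gal, hc' M', map_zpow]
    rw [← hordξ M]
    exact zpow_eq_zpow_iff_modEq.1 h
  -- `τ⁻¹ q_X ∈ K`: `τ` normalises `G_K = aug(Π^tp_{X̲̲})` by (HGAL)
  have hGK : ∀ σ : GQp p, σ ∈ D.K.fixingSubgroup ↔ ∃ g : Pi C, aug C g = σ := by
    intro σ
    have h : σ ∈ D.GK ↔ σ ∈ C.Huu.map D.aug.toMonoidHom := by rw [C.map_aug_Huu]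
    constructor
    · intro hσ
      obtain ⟨x, hx, hxσ⟩ := h.1 hσ
      exact ⟨⟨x, hx⟩, hxσ⟩
    · rintro ⟨g, rfl⟩
      exact h.2 ⟨(g : D.PiTemp), g.2, rfl⟩
  have hτq : τ.symm D.qX ∈ D.K := by
    apply PadicAlgCl.mem_of_forall_fixing D.K
    intro σ hσ
    obtain ⟨g, hg⟩ := (hGK σ).1 hσ
    have hmem : τ * σ * τ⁻¹ ∈ D.K.fixingSubgroup := (hGK _).2 ⟨α g, by rw [hgal, hg]⟩
    have hfix : (τ * σ * τ⁻¹) D.qX = D.qX := (IntermediateField.mem_fixingSubgroup_iff _ _).1 hmem _ D.qX_mem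
    have : σ (τ.symm D.qX) = τ.symm ((τ * σ * τ⁻¹) D.qX) := by
      rw [AlgEquiv.mul_apply, AlgEquiv.mul_apply, AlgEquiv.aut_inv, AlgEquiv.symm_apply_apply]
    rw [this, hfix]
  -- THE KUMMER–VALUATION RIGIDITY gives `u M ≡ c M (mod M)`
  have huc : ∀ M : ℕ+, u M ≡ c M [ZMOD M] := by
    refine PadicAlgCl.kummer_valuation_rigidity D.K D.qX_mem D.qX_ne_zero D.norm_qX_lt_one τ hτq C.l_ne_zero u c
      hucomp hccomp fun M => ?_
    -- level `M`: the data
    haveI : NeZero ((M : ℕ+) : ℕ) := ⟨M.ne_zero⟩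
    set w₀ : MuN p M := (τw.modAll M).red ⟨phi C (y M * B * (y M)⁻¹ * B⁻¹),
      phi_commutator_mem_lDeltaTheta C (hy M) hB⟩ ^ d M with hw₀
    set W : MuN p M := w M ^ (1 - u M) * w₀ with hW
    refine ⟨ζ M, ((ξ M : (PadicAlgCl p)ˣ) : PadicAlgCl p), r M, ((W : (PadicAlgCl p)ˣ) : PadicAlgCl p), hζ M,
      IsPrimitiveRoot.coe_units_iff.2 (IsPrimitiveRoot.coe_submonoidClass_iff.2 (hξ M)), ?_, hr M, ?_, ?_⟩
    · -- `W^M = 1`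
      have h := W.2
      rw [mem_rootsOfUnity] at h
      have := congrArg (fun u : (PadicAlgCl p)ˣ => (u : PadicAlgCl p)) h
      simpa using this
    · -- `τ ζ = ζ^{c M}`
      have h := hc' M (hζ M).toRootsOfUnity
      have := congrArg (fun u : MuN p M => ((u : (PadicAlgCl p)ˣ) : PadicAlgCl p)) h
      simp only [galMuN_apply_coe] at this
      rw [IsPrimitiveRoot.val_toRootsOfUnity_coe] at this
      rw [this]
      push_cast
      rw [IsPrimitiveRoot.val_toRootsOfUnity_coe]
    · -- the relation for `σ = aug g`
      intro σ hσ m n hm hn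
      obtain ⟨g, hg⟩ := (hGK σ).1 hσ
      have hζM : ζ M ^ ((M : ℕ+) : ℕ) = 1 := (hζ M).pow_eq_one
      -- reduce the exponents mod `M`
      set m' : ℕ := (m % (M : ℤ)).toNat with hm'
      set n' : ℕ := (n % (M : ℤ)).toNat with hn'
      have hm1 : D.aug (g : D.PiTemp) (r M) = ζ M ^ m' * r M := by
        rw [← zpow_eq_pow_toNat_field hζM m, ← hm, ← hg]; rfl
      have hn1 : D.aug ((α g : Pi C) : D.PiTemp) (r M) = ζ M ^ n' * r M := by
        rw [← zpow_eq_pow_toNat_field hζM n, ← hn]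
        change aug C (α g) (r M) = _
        rw [hgal, hg]
      have hκg := hκ M g m' hm1
      have hκαg := hκ M (α g) n' hn1
      have hrelg := hrel M g
      -- everything in `μ_M`
      have hgalα : ∀ x : MuN p M, galMuN p M (aug C (α g)) x = galMuN p M (aug C g) x := fun x => by
        rw [hgal]; exact galMuN_conj_apply _ _ _
      rw [hκg, hκαg, hgalα, hgalα] at hrelg
      -- solve for the coboundary
      set A : MuN p M := galMuN p M (aug C g) (w M) * (w M)⁻¹ with hA
      set A₀ : MuN p M := galMuN p M (aug C g) w₀ * w₀⁻¹ with hA₀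
      have hrelg' : (ξ M ^ (l * m') * A) ^ u M = ξ M ^ (l * n') * A * A₀ := hrelg
      have hsolve : ξ M ^ ((l : ℤ) * (u M * m' - n')) = A ^ (1 - u M) * A₀ := by
        rw [← zpow_natCast (ξ M) (l * m'), ← zpow_natCast (ξ M) (l * n'), mul_zpow, ← zpow_mul] at hrelg'
        have e2 : ξ M ^ (((l * m' : ℕ) : ℤ) * u M) = ξ M ^ ((l * n' : ℕ) : ℤ) * A * A₀ * (A ^ u M)⁻¹ :=
          eq_mul_inv_of_mul_eq hrelg'
        have e3 : ξ M ^ ((l : ℤ) * (u M * m' - n')) = ξ M ^ (((l * m' : ℕ) : ℤ) * u M) * (ξ M ^ ((l * n' : ℕ) : ℤ))⁻¹ := by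
          rw [← zpow_sub]; push_cast; ring_nf
        rw [e3, e2, mul_right_comm _ (A ^ u M)⁻¹, mul_right_comm _ A₀, mul_right_comm _ A, mul_inv_cancel, one_mul,
          mul_right_comm, zpow_sub, zpow_one]
      -- the coboundary of `W`
      have hWcob : A ^ (1 - u M) * A₀ = galMuN p M (aug C g) W * W⁻¹ := by
        rw [hW, map_mul, map_zpow, mul_inv, hA, hA₀, mul_zpow, inv_zpow, mul_mul_mul_comm]
      -- exponents mod `M` on `ξ`
      have hξM : ξ M ^ ((M : ℕ+) : ℕ) = 1 := hMpow M _
      have hexp : ξ M ^ ((l : ℤ) * (u M * m - n)) = ξ M ^ ((l : ℤ) * (u M * m' - n')) := by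
        have hM0 : (0 : ℤ) < (M : ℤ) := by exact_mod_cast M.pos
        have hm2 : (m' : ℤ) ≡ m [ZMOD M] := by
          rw [hm', Int.toNat_of_nonneg (Int.emod_nonneg _ hM0.ne')]; exact Int.mod_modEq m M
        have hn2 : (n' : ℤ) ≡ n [ZMOD M] := by
          rw [hn', Int.toNat_of_nonneg (Int.emod_nonneg _ hM0.ne')]; exact Int.mod_modEq n M
        rw [zpow_eq_zpow_iff_modEq, hordξ M]
        exact (((hm2.symm.mul_left (u M)).sub hn2.symm).mul_left (l : ℤ))
      -- pass to `ℚ̄_p`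
      rw [div_eq_mul_inv]
      have hval := congrArg (fun x : MuN p M => ((x : (PadicAlgCl p)ˣ) : PadicAlgCl p)) (hexp.trans (hsolve.trans hWcob))
      simp only at hval
      push_cast at hval
      rw [hval, galMuN_apply_coe, hg]
  -- conclusion at level `M`
  intro M z wz hzw
  have h1 := hu M z wz hzw
  rw [h1, hc' M]
  have hzM : (τw.modAll M).red z ^ ((M : ℕ+) : ℕ) = 1 := hMpow M _
  obtain ⟨k, hk⟩ := (Int.modEq_iff_dvd.1 (huc M).symm)
  have : u M = c M + (M : ℤ) * k := by linarith
  rw [this, zpow_add, zpow_mul, zpow_natCast, hzM, one_zpow, mul_one]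

/-- **The binder `hgal` from its Galois half**: «∀ α ∃ τ ∈ G_{ℚ_p}, (HGAL)» ⟹ «∀ α ∃ τ, (HGAL) ∧ (HCYC)» — the hypothesis
`hgal` of `EtaleLevels.prop34i_multiradiallyDefined_saturated_of{Galois,Core,Cor28i}` and of abc-iut-w4-d007's
`hsemi_units_of_galois`, verbatim. [cite: Mochizuki2012, Prop 3.4 (i) p.92] -/
theorem hgal_of_hgalois (hO : D.IsEtThOrigin)
    (hYcl : (D.DtpY.map D.toHat.toMonoidHom).topologicalClosure ≤
      D.DtpY.map D.toHat.toMonoidHom ⊔ (⁅⁅D.DeltaHat, D.DeltaHat⁆, D.DeltaHat⁆).topologicalClosure)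
    (hT : D.IsTateOrigin) (hS : D.Sec2Hyps) (hq : IsQuotientMap D.toTheta) {N : ℕ+} (μ : D.CyclotomeMod l N)
    (hC : D.Compat) (h15 : D.Prop15iii E hC) (L : C.CuspLabels) (R : RigidData.{0} N l)
    (hR : R = C.rigidData μ hC hS h15 L) (h218i : R.Cor218_i) {Es : Set ℕ+} (τw : D.CyclotomeTower l Es)
    (hHGAL : ∀ α : (Pi C) ≃ₜ* (Pi C), ∃ τ : GQp p, ∀ x : Pi C, aug C (α x) = τ * aug C x * τ⁻¹) :
    ∀ α : (Pi C) ≃ₜ* (Pi C), ∃ τ : GQp p,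
      (∀ x : Pi C, aug C (α x) = τ * aug C x * τ⁻¹) ∧
      (∀ (M : ℕ+) (z w : D.lDeltaTheta l),
        ((rangeAutOfCor218i C μ hq hC hS h15 L R hR h218i α
            ⟨(z : D.GtpTheta), lDeltaTheta_le_phiRange C z.2⟩ : phiRange C) : D.GtpTheta) = (w : D.GtpTheta) →
          (τw.modAll M).red w = galMuN p M τ ((τw.modAll M).red z)) := by
  intro α
  obtain ⟨τ, h⟩ := hHGAL α
  exact ⟨τ, h, hcyc_of_hgal C hO hYcl hT hS hq μ hC h15 L R hR h218i τw α τ h⟩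

end EtaleThetaDataOfSetting

end Literature.IUT.HodgeArakelov

end
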